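import Summits.MatrixMultiplication.MatrixMultiplication.Theses.EisensteinValCertificates
import Summits.MatrixMultiplication.MatrixMultiplication.Theses.FourierTwoFamiliesModP
import Literature.Computability.AlgebraicComplexity.SimultaneousDoubleProduct
import Summits.MatrixMultiplication.MatrixMultiplication.Theorems.EisensteinValCertificatesHomocyclicSTPPDesignsLeafSandwich
import Summits.MatrixMultiplication.MatrixMultiplication.Theorems.EisensteinValCertificatesHomocyclicSTPPDesignsBalancedLeaf

set_option linter.dupNamespace false

/-!
# The clustered two-families leaf BY NAME: glue `LeafGivesDesigns` and the typed sandwich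

Route `EisensteinValCertificates`, crux `HomocyclicSTPPDesigns` (stmt-MatrixMultiplication-10647) = X′.
Since the rev-5 route repair (2026-08-17) the one open stub of the registered line
`Cruxes/HomocyclicSTPPDesigns/Lines/clustered_charts.lean` is a route DECL,
`EisensteinValCertificates.ClusteredTwoFamilies` (item stmt-MatrixMultiplication-18134): the registered
signature verbatim, with the difference sets `A i - B i` spelled `Finset.image₂ (· - ·) (A i) (B i)` —
DEFINITIONALLY the same term (`Finset.sub = ⟨Finset.image₂ (· - ·)⟩`), so every landed theorem about the
leaf applies to the decl by `Iff.rfl`/unfolding.  This file records that by name: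

* `clusteredTwoFamilies_iff_leaf` — the decl unfolds to the registered stub signature (`Iff.rfl`);
* `leafGivesDesigns_holds : LeafGivesDesigns` — item stmt-MatrixMultiplication-18135 VERBATIM
  (`ClusteredTwoFamilies → HomocyclicSTPPDesigns`), from the landed reduction
  `homocyclicSTPPDesigns_of_clusteredTwoFamilies` (p155276): the leaf is load-bearing for `closes`;
* `homocyclicSTPPDesigns_of_clusteredTwoFamilies_decl` — the same arrow with the decl as hypothesis;
* `clusteredTwoFamilies_of_primeTwoFamilies` — `PrimeTwoFamilies → ClusteredTwoFamilies` (stmt-14308 ⟹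
  stmt-18134; `stub_clusteredOfPrimeTwoFamilies`, p154020);
* `not_clusteredTwoFamilies_decl_of_primeCyclicPowerGain`, `not_clusteredTwoFamilies_decl_of_noHomocyclicSTPP`
  — the kill links stmt-14309 ⟹ ¬stmt-18134 and stmt-7787 ⟹ ¬stmt-18134 (p156608, p155276);
* `clusteredTwoFamilies_decl_iff_balanced` — the decl is equivalent to its BALANCED form
  `|A_i| = |B_i| = s ≥ 2` (lead c4's normal form, p159859), the vocabulary of 14309/14310/14311;
* `clusteredTwoFamilies_decl_sandwich` — the four arrows packaged against the decl.

No new mathematics: bookkeeping that makes the promoted item and the landed theorems meet by name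
(lead c5 of the crux protocol on stmt-10647; the skeleton's `stub_clusteredTwoFamilies` is now stated as
`ClusteredTwoFamilies` itself).
-/

namespace Summit.MatrixMultiplication.MatrixMultiplication.Theorems.HomocyclicSTPPDesigns.ClusteredCharts

open Summit.MatrixMultiplication.MatrixMultiplication.Theses.EisensteinValCertificates
open Summit.MatrixMultiplication.MatrixMultiplication.Theses.FourierTwoFamiliesModP (PrimeTwoFamilies
  PrimeCyclicPowerGain)
open Literature.Computability.AlgebraicComplexity Finset
open scoped BigOperators Pointwise

/-- The route decl `ClusteredTwoFamilies` (stmt-MatrixMultiplication-18134) unfolds, definitionally, to the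
registered stub signature of the line (difference sets written with pointwise `-`). -/
theorem clusteredTwoFamilies_iff_leaf :
    ClusteredTwoFamilies ↔
      ∀ ε : ℝ, 0 < ε → ∃ p : ℕ, p.Prime ∧ ∃ (n m a b d : ℕ) (A B : Fin n → Finset (ZMod p))
        (cls : Fin n → Fin m), IsSDPP A B ∧ 2 ≤ a * b ∧ (∀ i, (A i).card = a ∧ (B i).card = b) ∧
        (∀ i j, cls i ≠ cls j → Disjoint (A i - B i) (A j - B j)) ∧
        (∀ c : Fin m, d ≤ (Finset.univ.filter fun i => cls i = c).card) ∧
        (p : ℝ) < (m : ℝ) * (d : ℝ) ^ ((2 : ℝ) / 3) * ((a * b : ℕ) : ℝ) ^ ((2 + ε) / 3) :=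
  Iff.rfl

/-- Item stmt-MatrixMultiplication-18135 `LeafGivesDesigns`, VERBATIM: the clustered two-families leaf
(stmt-18134) gives homocyclic prime-power STPP designs beating every `2 + ε` (stmt-10647), by the landed
reduction `homocyclicSTPPDesigns_of_clusteredTwoFamilies` (clustered chart amplification, p155276). -/
theorem leafGivesDesigns_holds : LeafGivesDesigns := fun h =>
  homocyclicSTPPDesigns_of_clusteredTwoFamilies h

/-- The reduction with the route decl as hypothesis: `ClusteredTwoFamilies → HomocyclicSTPPDesigns`. -/
theorem homocyclicSTPPDesigns_of_clusteredTwoFamilies_decl (h : ClusteredTwoFamilies) :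
    HomocyclicSTPPDesigns :=
  homocyclicSTPPDesigns_of_clusteredTwoFamilies h

/-- stmt-14308 ⟹ stmt-18134: CKSU Conj. 4.7 at primes (`PrimeTwoFamilies`) gives the clustered leaf with one
class (`stub_clusteredOfPrimeTwoFamilies`, dyadic uniformisation, p154020). -/
theorem clusteredTwoFamilies_of_primeTwoFamilies (hTF : PrimeTwoFamilies) : ClusteredTwoFamilies :=
  stub_clusteredOfPrimeTwoFamilies hTF

/-- stmt-14309 ⟹ ¬ stmt-18134: a power gain for balanced SDPP configurations in prime cyclic groups
(`PrimeCyclicPowerGain`) refutes the clustered leaf (packing + comparability + shrinking, p155804/p156608). -/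
theorem not_clusteredTwoFamilies_decl_of_primeCyclicPowerGain (hPG : PrimeCyclicPowerGain) :
    ¬ ClusteredTwoFamilies :=
  not_clusteredTwoFamilies_of_primeCyclicPowerGain hPG

/-- stmt-7787 ⟹ ¬ stmt-18134: the route's negative milestone `NoHomocyclicSTPP` (= ¬X′) refutes the
clustered leaf, through the reduction (p155276). -/
theorem not_clusteredTwoFamilies_decl_of_noHomocyclicSTPP (hNo : NoHomocyclicSTPP) :
    ¬ ClusteredTwoFamilies :=
  not_clusteredTwoFamilies_of_noHomocyclicSTPP hNo

/-- The route decl is equivalent to its BALANCED form (`|A_i| = |B_i| = s ≥ 2`, merit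
`m · d^{2/3} · (s·s)^{(2+ε)/3} > p`): lead c4's normal form `clusteredTwoFamilies_iff_balanced` (p159859),
read against the decl. -/
theorem clusteredTwoFamilies_decl_iff_balanced :
    ClusteredTwoFamilies ↔
      ∀ ε : ℝ, 0 < ε → ∃ p : ℕ, p.Prime ∧ ∃ (n m s d : ℕ) (A B : Fin n → Finset (ZMod p))
        (cls : Fin n → Fin m), IsSDPP A B ∧ 2 ≤ s ∧ (∀ i, (A i).card = s ∧ (B i).card = s) ∧
        (∀ i j, cls i ≠ cls j → Disjoint (A i - B i) (A j - B j)) ∧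
        (∀ c : Fin m, d ≤ (Finset.univ.filter fun i => cls i = c).card) ∧
        (p : ℝ) < (m : ℝ) * (d : ℝ) ^ ((2 : ℝ) / 3) * ((s * s : ℕ) : ℝ) ^ ((2 + ε) / 3) :=
  clusteredTwoFamilies_iff_balanced

/-- The typed sandwich against the route decl (all four arrows are landed theorems):
`PrimeTwoFamilies ⟹ ClusteredTwoFamilies ⟹ HomocyclicSTPPDesigns`, and
`PrimeCyclicPowerGain ⟹ ¬ClusteredTwoFamilies`, `NoHomocyclicSTPP ⟹ ¬ClusteredTwoFamilies`. -/
theorem clusteredTwoFamilies_decl_sandwich :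
    (PrimeTwoFamilies → ClusteredTwoFamilies) ∧ (ClusteredTwoFamilies → HomocyclicSTPPDesigns) ∧
      (PrimeCyclicPowerGain → ¬ ClusteredTwoFamilies) ∧ (NoHomocyclicSTPP → ¬ ClusteredTwoFamilies) :=
  ⟨clusteredTwoFamilies_of_primeTwoFamilies, homocyclicSTPPDesigns_of_clusteredTwoFamilies_decl,
    not_clusteredTwoFamilies_decl_of_primeCyclicPowerGain, not_clusteredTwoFamilies_decl_of_noHomocyclicSTPP⟩

end Summit.MatrixMultiplication.MatrixMultiplication.Theorems.HomocyclicSTPPDesigns.ClusteredCharts
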